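import Summits.ABC.ABC.Theses.DefiniteXi
import Summits.ABC.ABC.Theorems.DefiniteXiFreyModularity
import Summits.ABC.ABC.Theorems.DefiniteXiDefiniteRTControlPrime
import Summits.ABC.ABC.Theorems.DefiniteXiDefiniteRTControlPrimeSmulTransportDeg
import Summits.ABC.ABC.Theorems.DefiniteXiDefiniteRTControlPrimeValTransport
import Summits.ABC.ABC.Theorems.DefiniteXiDefiniteRTControlPrimeFreyScale
import Summits.ABC.ABC.Theorems.DefiniteXiDefiniteRTControlPrimeFreyLocal
import Summits.ABC.ABC.Theorems.IsogenyGlueCongruenceMazurKenkuBoundLevelThirtyTwo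
import Literature.NumberTheory.EllipticCurves.TakahashiDegreeFormulaCoprimeProofs
import Literature.NumberTheory.EllipticCurves.PastenSpectralDegree
import Literature.NumberTheory.EllipticCurves.PastenHeightBounds
import Literature.NumberTheory.EllipticCurves.PastenHeightBoundsLemma68LocalProofs
import Literature.NumberTheory.EllipticCurves.ModularCurveManinSemistableBridgeProofs
import Literature.NumberTheory.EllipticCurves.ModularDegreeMinimal
import Literature.NumberTheory.EllipticCurves.IsogenyVariableChangeProofs
import Literature.NumberTheory.EllipticCurves.IsogenyCompProofs
import Literature.NumberTheory.EllipticCurves.IsogenyDualProofs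
import Literature.NumberTheory.EllipticCurves.RationalTwoTorsionSemistableModPIrreducibleProofs
import Literature.NumberTheory.EllipticCurves.RationalTwoTorsionModPIrreducibleProofs
import Literature.NumberTheory.EllipticCurves.MazurTorsionLocalStepsProofs
import Literature.NumberTheory.EllipticCurves.MazurTorsionSplit
import Literature.NumberTheory.EllipticCurves.Tamagawa
import Literature.NumberTheory.EllipticCurves.KleinFrickeLevelTwentySeven
import Literature.NumberTheory.EllipticCurves.RationalIsogenyDegreesProofs
import Literature.NumberTheory.DiophantineGeometry.GeneralizedFermatTwoPowerCoefficientFreyProofs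
import Literature.NumberTheory.DiophantineGeometry.DenesEquationLargeExponentsProofs
import HarnessLib

/-!
# stub-ideation k3 · gen 8 — `stub_pastenLemma68` (crux stmt-ABC-11338 `DefiniteRTControlPrime`)
# FAMILY 3 (probe the extremes): the 2-ADIC EXTREMES of the Frey family decide the radius

Companion of `STUB-IDEAS-stub_pastenLemma68-3.md` (gen 8).  Standing verdict on the VERBATIM stub
(`PastenShimura2024_lemma_6_8`, Mazur–Kenku-complete, `prime_degree_le_163_of_PastenShimura2024_lemma_6_8`)
is unchanged; this file types the gen-8 plan for WHAT THE STUB SUPPLIES to the line (`hval`, one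
Frey pair, free constant) — the rooted Frey radius — from the three 2-adic regimes of the normalised
Frey curve `E_(A,B)` (`A ≡ −1 (4)`, `2 ∣ B`; `v = ord₂ B`):

* T3 `v ≤ 3` (wild at `2`): odd Swan conductor ⇒ `E[p]` irreducible for EVERY odd `p` — tree, general `p`
  (`hasIrreducibleModPGaloisRep_of_swanConductorAt_torsion_eq_one` + parity + `ℓ`-independence).
* T2 `v = 4` (GOOD at `2`): Serre's dichotomy (`Edixhoven1997_prop_2_1_holds`, general `p`) puts a
  rational point of order `p` on `E` or `E/H`, both good at `2`; Mazur 1977 Step 2 at `q = 2`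
  (tree `Mazur1977_stepTwo_padic`: a rational point of prime order `N > 5` forces SPLIT MULTIPLICATIVE
  reduction at `2`) kills `p ≥ 7`; Kubert (tree) kills `p = 5`.  NEW and UNCONDITIONAL.
* T1 `v ≥ 5` (multiplicative at `2`, the FLT regime): the landed per-prime Ribet Prop. 1
  (`…_of_leaves`) with `h14` now a THEOREM (`not_exists_addOrderOf_eq_fourteen`); inputs left:
  `MazurTate1973_no_torsion_thirteen` (h13) and `Mazur1977_stepThree_eisenstein` (hE, `p ≥ 17` only).
* degenerate extreme `2A + B = 0` (`|ab(a+b)| = 2`, `y² = x³ − x`, `N = 32`): no odd conductor prime —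
  vacuous for the crux / the radius leaf.

Hence prime support `{2,3}` for cyclic isogenies out of Frey curves with an odd conductor prime, so
(E27 `X₀(27)` + L32, both landed) cyclic degree `≤ 2⁴·3² = 144`: `FreyIsogenyRadius 144` from
`h13 + hE` alone (k2-g3 needed Mazur 1978 Cor. 4.4 = OPEN item stmt-ABC-18223 + Klein–Fricke 13);
by k2-g4's PROVED `definiteRTControlPrime_of_rooted` the crux follows from `stub_takahashi + h13 + hE`
— no `stub_pasten163`, no `stub_pastenLemma68`, no Mazur 1978, no Kenku tables beyond 27/32.

Sorry census (8): helper bodies H0, H1, H3', H4, H5 (each ≤ 1 prover cycle, template named in the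
docstring), the k2-g4 transplant G (PROVED there; re-checked today rc 0 / 0 sorry) and the two
tree-theorem pointers K5, T1 (one-line `exact`s; their modules have no hub olean tonight);
H2, B5, A144, E27, H3, H6, H6', SUPP, R144, VAL and the top assembly are kernel-checked.
-/

set_option linter.dupNamespace false

noncomputable section

open scoped Classical
open WeierstrassCurve IsDedekindDomain NumberField
open Literature.NumberTheory.EllipticCurves Literature.NumberTheory.EllipticCurves.ModularForms
open Literature.NumberTheory.DiophantineGeometry
open Summit.ABC.ABC.Theorems Summit.ABC.ABC.Theorems.DefiniteRTControlPrime
open Summit.ABC.ABC.Theses.DefiniteXi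

namespace Summit.ABC.ABC.Cruxes.DefiniteRTControlPrime.StubIdeas3G8

/-! ## 0. The leaf (k2-g2/g3/g4 `FreyIsogenyRadius`, verbatim) -/

/-- Rooted radius of the Frey isogeny class at an odd conductor prime (k2 leaf, same text). -/
def FreyIsogenyRadius (R : ℕ) : Prop :=
  ∀ (a b : ℤ), IsCoprime a b → a * b * (a + b) ≠ 0 → ∀ q : ℕ, q.Prime → q ≠ 2 →
    q ∣ (freyCurve a b).conductorNorm ℤ →
    ∀ (W' : WeierstrassCurve ℚ) [W'.IsElliptic], (freyCurve a b).IsIsogenous W' →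
      ∃ φ : Isogeny (freyCurve a b) W', φ.degree ≤ R

/-! ## 0'. Two tree theorems restated as pointers

`noTwoTorsionPrime_five` and `…_of_leaves` (+ `not_exists_addOrderOf_eq_fourteen`) are PROVED in
the accepted modules `RationalTwoTorsionSemistableModPIrreduciblePerPrimeProofs` / `KubertFourteenProofs`,
which have no hub olean tonight (farm answers `remote:stale:…:unbuilt:` for any file importing
them), so they are restated here by signature; each closes by the one-line `exact` in its docstring. -/

/-- **K5 (tree theorem; pointer).** Kubert 1976: no `ℤ/2 × ℤ/10` over `ℚ`.  Closes by
`exact noTwoTorsionPrime_five V hP₁ hP₂ h12 hQ` (RationalTwoTorsionSemistableModPIrreduciblePerPrimeProofs:113).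
[cite: Kubert1976, Ch. IV] -/
theorem noTwoTorsionPrime_five' (V : WeierstrassCurve ℚ) [V.IsElliptic]
    {P₁ P₂ Q : V.toAffine.Point} (hP₁ : addOrderOf P₁ = 2) (hP₂ : addOrderOf P₂ = 2)
    (h12 : P₁ ≠ P₂) (hQ : addOrderOf Q = 5) : False := by
  sorry

/-- **T1 (tree theorem; pointer).** Ribet 1997 Prop. 1 per prime from the torsion leaves, with
`h14` DISCHARGED by the tree theorem `not_exists_addOrderOf_eq_fourteen` (KubertFourteenProofs:55).
Closes by `exact hasIrreducibleModPGaloisRep_of_isSemistable_of_rational_two_torsion_of_leaves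
(fun V _ ↦ not_exists_addOrderOf_eq_fourteen V) h13 hE W hW h2 hp h5`
(RationalTwoTorsionSemistableModPIrreduciblePerPrimeProofs:354). [cite: Ribet1997, Prop. 1 (p. 11–12)] -/
theorem hasIrreducibleModPGaloisRep_of_torsionLeaves
    (h13 : ∀ V : WeierstrassCurve ℚ, MazurTate1973_no_torsion_thirteen V)
    (hE : Mazur1977_stepThree_eisenstein)
    (W : WeierstrassCurve ℚ) [W.IsElliptic] (hW : W.IsSemistable ℤ)
    (h2 : ∀ (σ : Field.absoluteGaloisGroup ℚ) (P : W.geomPoints), 2 • P = 0 → σ • P = P)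
    {p : ℕ} (hp : p.Prime) (h5 : 5 ≤ p) : W.HasIrreducibleModPGaloisRep p := by
  sorry

/-! ## 1. Regime T2 — good reduction at `2` (the new, unconditional branch) -/

/-- **H1 (S–M).** Ribet 1997 Prop. 1 / Serre 1987 §4.1 Prop. 6 for ONE prime `p ≥ 5`, with the
torsion hypothesis `(⋆ₚ)` RESTRICTED TO THE ISOGENY CLASS of `W`: the tree proof of
`hasIrreducibleModPGaloisRep_of_isSemistable_of_rational_two_torsion_of_noTwoTorsionPrime`
(RationalTwoTorsionSemistableModPIrreduciblePerPrimeProofs) verbatim — it feeds `(⋆ₚ)` only with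
`W` itself and with the quotient `W/H` (`exists_isogeny_ker_eq_and_comp_eq_nsmul_holds`), both
`ℚ`-isogenous to `W` (`IsIsogenous.refl`, `⟨g⟩`). [cite: Ribet1997, Prop. 1] [cite: Serre1972, §5.4 Prop. 21] -/
theorem hasIrreducibleModPGaloisRep_of_isSemistable_of_classNoTwoTorsionPrime {p : ℕ}
    (W : WeierstrassCurve ℚ) [W.IsElliptic] (hW : W.IsSemistable ℤ)
    (h2 : ∀ (σ : Field.absoluteGaloisGroup ℚ) (P : W.geomPoints), 2 • P = 0 → σ • P = P)
    (hNo : ∀ (V : WeierstrassCurve ℚ) [V.IsElliptic], W.IsIsogenous V →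
      ∀ (P₁ P₂ Q : V.toAffine.Point),
        addOrderOf P₁ = 2 → addOrderOf P₂ = 2 → P₁ ≠ P₂ → addOrderOf Q = p → False)
    (hp : p.Prime) (h5 : 5 ≤ p) : W.HasIrreducibleModPGaloisRep p := by
  sorry

/-- **H2 (XS, PROVED) — the new lever: a curve with GOOD reduction at `2` has no rational point of
prime order `N ≥ 7`.**  Mazur 1977 Ch. III §5 Step 2 at `q = 2` (tree `Mazur1977_stepTwo_padic`,
`2·2+1 < N`): such a point forces split multiplicative reduction of the `ℤ₂`-minimal model, whose
discriminant valuation is then `< 1` and `= 1` at once. [cite: Mazur1977, Ch. III §5, Step 2 (p. 158)] -/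
theorem false_of_hasGoodReductionAtPrime_two_of_addOrderOf (V : WeierstrassCurve ℚ) [V.IsElliptic]
    (hgood : V.HasGoodReductionAtPrime 2) {N : ℕ} (hN : N.Prime) (h7 : 7 ≤ N)
    {Q : V.toAffine.Point} (hQ : addOrderOf Q = N) : False := by
  obtain ⟨-, hsplit, -⟩ := Mazur1977_stepTwo_padic V 2 hN hQ (by omega)
  have hg : ((V.baseChange ℚ_[2]).minimal ℤ_[2]).HasGoodReduction ℤ_[2] := hgood
  have hm : ((V.baseChange ℚ_[2]).minimal ℤ_[2]).HasMultiplicativeReduction ℤ_[2] :=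
    hsplit.hasMultiplicativeReductionAtPrime
  exact hm.badReduction.ne hg.goodReduction

/-- **H3' (XS).** Good reduction at a prime is an isogeny invariant (Silverman *AEC* VII.7.2; tree:
`IsIsogenous.hasGoodReductionAt_iff_of_isIsogenous` (places of `𝓞 ℚ`) +
`hasGoodReductionAtPrime_iff_hasGoodReductionAt_ringOfIntegers`; verbatim in
`Summits/BirchSwinnertonDyer/Rank1Residual/X2/IsogenyLineTypeGoodOrdinary.lean`
`hasGoodReductionAtPrime_of_isIsogenous`). [cite: SilvermanAEC2009, Cor. VII.7.2] -/
theorem hasGoodReductionAtPrime_of_isIsogenous' {W V : WeierstrassCurve ℚ} [W.IsElliptic]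
    [V.IsElliptic] (h : W.IsIsogenous V) (p : ℕ) [Fact p.Prime]
    (hW : W.HasGoodReductionAtPrime p) : V.HasGoodReductionAtPrime p := by
  sorry

/-- **H3 (PROVED from H1 H2 H3').  Regime T2 in general form, UNCONDITIONAL modulo the helpers:**
a semistable `E/ℚ` with all `2`-torsion rational and GOOD reduction at `2` has irreducible `E[p]`
for every prime `p ≥ 5` (`p = 5`: Kubert, tree `noTwoTorsionPrime_five`; `p ≥ 7`: H2 on `E` or
`E/H`, both good at `2`).  No Mazur 1977/1978, no modular curve beyond `X₁(2,10)`. -/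
theorem hasIrreducibleModPGaloisRep_of_isSemistable_of_two_torsion_of_goodAtTwo {p : ℕ}
    (W : WeierstrassCurve ℚ) [W.IsElliptic] (hW : W.IsSemistable ℤ)
    (h2 : ∀ (σ : Field.absoluteGaloisGroup ℚ) (P : W.geomPoints), 2 • P = 0 → σ • P = P)
    (hgood : W.HasGoodReductionAtPrime 2) (hp : p.Prime) (h5 : 5 ≤ p) :
    W.HasIrreducibleModPGaloisRep p := by
  refine hasIrreducibleModPGaloisRep_of_isSemistable_of_classNoTwoTorsionPrime W hW h2 ?_ hp h5
  intro V _ hiso P₁ P₂ Q hP₁ hP₂ h12 hQ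
  by_cases hp5 : p = 5
  · subst hp5
    exact noTwoTorsionPrime_five' V hP₁ hP₂ h12 hQ
  · have h7 : 7 ≤ p := by
      by_contra h
      interval_cases p
      · exact hp5 rfl
      · exact absurd hp (by norm_num)
    exact false_of_hasGoodReductionAtPrime_two_of_addOrderOf V
      (hasGoodReductionAtPrime_of_isIsogenous' hiso 2 hgood) hp h7 hQ

/-- **H4 (S).** The normalised Frey curve with `2⁴ ∥ B` has GOOD reduction at `2`: the model
`freyIntModel₂` (`x = 4X, y = 8Y + 4X`; tree `smul_freyCurve_eq_baseChange_freyIntModel₂`,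
`freyIntModel₂_Δ = (AB(A+B))²/2⁸`, `freyIntModel₂_c₄` odd, `isMinimalAt_freyIntModel₂`) has
`ord₂ Δ = 2·4 − 8 = 0`; transport to the `ℤ₂`-minimal model by
`hasGoodReductionAtPrime_iff_of_variableChange`. [cite: DiamondKramer1995, §1] [cite: Ribet1997, §2 p. 11] -/
theorem hasGoodReductionAtPrime_two_freyCurve {A B : ℤ} (hAB : IsCoprime A B)
    (h0 : A * B * (A + B) ≠ 0) (hA : A ≡ -1 [ZMOD 4]) (h16 : (16 : ℤ) ∣ B) (h32 : ¬ (32 : ℤ) ∣ B) :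
    haveI := isElliptic_freyCurve h0
    (freyCurve A B).HasGoodReductionAtPrime 2 := by
  sorry

/-! ## 2. Regime T3 — wild at `2` (landed for `p = 5`, general `p` is the same proof) -/

/-- **H5 (S).** For the normalised Frey curve with `2 ∣ B`, `16 ∤ B`, `2A + B ≠ 0`, `E[p]` is
irreducible for EVERY odd prime `p`: `Sw_𝔓(E[3]) ∈ {1,3}` (tree
`swanConductorAt_torsion_three_freyCurve_of_two_mul` / the `4 ∣ B` class lemma of
DefiniteXiFreyModularityStubFreySwanOdd), `Sw_𝔓(E[p]) = Sw_𝔓(E[3])` (tree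
`swanConductorAt_rationalTate_eq_swanConductorAt_rationalTate p 3` with
`swanConductorAt_rationalTate_eq_swanConductorAt_torsion`, exactly as in
`swanConductorAt_torsion_five_eq_swanConductorAt_torsion_three` with `5 ↦ p`), and a reducible
`E[p]` has even Swan conductor (tree
`exists_swanConductorAt_torsion_eq_two_mul_of_not_hasIrreducibleModPGaloisRep`). [cite: DiamondKramer1995, Lemmas 2–3] -/
theorem hasIrreducibleModPGaloisRep_freyCurve_of_not_sixteen_dvd {A B : ℤ} (hAB : IsCoprime A B)
    (h0 : A * B * (A + B) ≠ 0) (hA : A ≡ -1 [ZMOD 4]) (hB : (2 : ℤ) ∣ B) (h16 : ¬ (16 : ℤ) ∣ B)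
    (h2AB : 2 * A + B ≠ 0) {p : ℕ} (hp : p.Prime) (hp2 : p ≠ 2) :
    (freyCurve A B).HasIrreducibleModPGaloisRep p := by
  sorry

/-! ## 3. All regimes: Frey rigidity at every `p ≥ 5` from `h13 + hE` (used in T1 only) -/

/-- **H6 (PROVED from H3 H4 H5 + tree).**  Normalised Frey curves: `E_(A,B)[p]` irreducible for
all primes `p ≥ 5`.  T1 (`32 ∣ B`): tree `…_of_leaves` with `h14 := not_exists_addOrderOf_eq_fourteen`
(THEOREM), `h13`, `hE`; T2 (`16 ∥ B`): H3 + H4; T3 (`16 ∤ B`): H5. -/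
theorem hasIrreducibleModPGaloisRep_freyCurve_normalised
    (h13 : ∀ V : WeierstrassCurve ℚ, MazurTate1973_no_torsion_thirteen V)
    (hE : Mazur1977_stepThree_eisenstein)
    {A B : ℤ} (hAB : IsCoprime A B) (h0 : A * B * (A + B) ≠ 0) (hA : A ≡ -1 [ZMOD 4])
    (hB : (2 : ℤ) ∣ B) (h2AB : 2 * A + B ≠ 0) {p : ℕ} (hp : p.Prime) (h5 : 5 ≤ p) :
    (freyCurve A B).HasIrreducibleModPGaloisRep p := by
  haveI := isElliptic_freyCurve h0
  by_cases h16 : (16 : ℤ) ∣ B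
  · by_cases h32 : (32 : ℤ) ∣ B
    · -- T1: the deep regime, torsion leaves (h14 is a theorem of the tree)
      exact hasIrreducibleModPGaloisRep_of_torsionLeaves h13 hE (freyCurve A B)
        (isSemistable_freyCurve_of_sixteen_dvd hAB h0 hA h16)
        (fun σ P hP ↦ smul_eq_of_two_nsmul_eq_zero_freyCurve h0 σ hP) hp h5
    · -- T2: good at `2`, unconditional
      exact hasIrreducibleModPGaloisRep_of_isSemistable_of_two_torsion_of_goodAtTwo (freyCurve A B)
        (isSemistable_freyCurve_of_sixteen_dvd hAB h0 hA h16)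
        (fun σ P hP ↦ smul_eq_of_two_nsmul_eq_zero_freyCurve h0 σ hP)
        (hasGoodReductionAtPrime_two_freyCurve hAB h0 hA h16 h32) hp h5
  · -- T3: wild at `2`, unconditional
    exact hasIrreducibleModPGaloisRep_freyCurve_of_not_sixteen_dvd hAB h0 hA hB h16 h2AB hp
      (by rintro rfl; omega)

/-- **H0 (XS).** Normalisation keeping track of the triple: `exists_normalised_freyCurve`
(DefiniteXiFreyModularityStubFreyFiveIrreducibleGlue) verbatim, recording that the normalised
triple is the original one up to signs/permutation, so `|AB(A+B)| = |ab(a+b)|` (the six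
presentations `(a,b), (−a,−b), (b,a), (−b,−a), (−a,a+b), (a,−a−b)`). [cite: DiamondKramer1995, Lemma 1] -/
theorem exists_normalised_freyCurve_natAbs {a b : ℤ} (hab : IsCoprime a b)
    (h0 : a * b * (a + b) ≠ 0) (p : ℕ) :
    ∃ A B : ℤ, IsCoprime A B ∧ A * B * (A + B) ≠ 0 ∧ A ≡ -1 [ZMOD 4] ∧ (2 : ℤ) ∣ B ∧
      (A * B * (A + B)).natAbs = (a * b * (a + b)).natAbs ∧
      ((freyCurve a b).HasIrreducibleModPGaloisRep p ↔
        (freyCurve A B).HasIrreducibleModPGaloisRep p) := by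
  sorry

/-- **H6' (PROVED from H0 H6): Frey rigidity at every `p ≥ 5`** for all coprime `a, b` with
`ab(a+b) ≠ 0` off the degenerate extreme `|ab(a+b)| = 2` (`y² = x³ − x`, conductor `32`, which
never meets an odd conductor prime).  `h13`, `hE` enter only when `32 ∣` the even member. -/
theorem hasIrreducibleModPGaloisRep_freyCurve
    (h13 : ∀ V : WeierstrassCurve ℚ, MazurTate1973_no_torsion_thirteen V)
    (hE : Mazur1977_stepThree_eisenstein)
    {a b : ℤ} (hab : IsCoprime a b) (h0 : a * b * (a + b) ≠ 0)
    (habs : (a * b * (a + b)).natAbs ≠ 2) {p : ℕ} (hp : p.Prime) (h5 : 5 ≤ p) :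
    (freyCurve a b).HasIrreducibleModPGaloisRep p := by
  obtain ⟨A, B, hAB, h0', hA, hB, hnat, hiff⟩ := exists_normalised_freyCurve_natAbs hab h0 p
  rw [hiff]
  have h2AB : 2 * A + B ≠ 0 := by
    intro h
    have hB' : B = -2 * A := by linarith
    have hunit : IsUnit A := hAB.isUnit_of_dvd' (dvd_refl A) ⟨-2, by rw [hB']; ring⟩
    apply habs
    rw [← hnat, hB']
    rcases Int.isUnit_iff.mp hunit with rfl | rfl <;> norm_num
  exact hasIrreducibleModPGaloisRep_freyCurve_normalised h13 hE hAB h0' hA hB h2AB hp h5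

/-! ## 4. Support `{2,3}` ⟹ cyclic degree `≤ 144` ⟹ `FreyIsogenyRadius 144` -/

/-- **B5 (PROVED; k2-g3 §1 verbatim).** Irreducible
`E[p]` ⟹ no cyclic `ℚ`-isogeny out of `E` of degree divisible by `p` (the kernel meets `E[p]` in a
stable subgroup of order `p`: `Isogeny.natCard_ker_inf_geomTorsion_of_isCyclic`,
`Mazur1978.not_hasIrreducibleModPGaloisRep_iff_exists_natCard_eq`). [cite: SilvermanAEC2009, III.4.12] -/
theorem not_dvd_degree_of_hasIrreducibleModPGaloisRep {W W' : WeierstrassCurve ℚ} [W.IsElliptic]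
    [W'.IsElliptic] (φ : Isogeny W W') (hφ : φ.IsCyclic) {p : ℕ} (hp : p.Prime)
    (hirr : W.HasIrreducibleModPGaloisRep p) : ¬ p ∣ φ.degree := by
  intro hpd
  haveI : Fact p.Prime := ⟨hp⟩
  -- `H = E[p] ∩ ker φ`, a `Γ_ℚ`-stable subgroup of `E[p]`
  set H : AddSubgroup (geomTorsion W (p : ℤ)) :=
    (φ.toAddMonoidHom.comp (geomTorsion W (p : ℤ)).subtype).ker with hH
  have hHmem : ∀ P : geomTorsion W (p : ℤ), P ∈ H ↔ φ (P : W.geomPoints) = 0 := fun P ↦ by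
    rw [hH, AddMonoidHom.mem_ker]
    rfl
  have hstab : ∀ σ : Field.absoluteGaloisGroup ℚ, ∀ P ∈ H, σ • P ∈ H := fun σ P hP ↦ by
    rw [hHmem] at hP ⊢
    rw [AddSubgroup.torsionBy.coe_smul, φ.map_smul, hP, smul_zero]
  rcases hirr H hstab with hbot | htop
  · -- Cauchy: `ker φ` has an element of order `p`, a non-zero point of `E[p] ∩ ker φ`
    obtain ⟨Q, hQ⟩ := exists_prime_addOrderOf_dvd_card' (G := φ.toAddMonoidHom.ker) p hpd
    have hQp : p • ((Q : φ.toAddMonoidHom.ker) : W.geomPoints) = 0 := by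
      have h := congrArg Subtype.val (addOrderOf_nsmul_eq_zero Q)
      rwa [hQ, AddSubmonoidClass.coe_nsmul] at h
    have hQ0 : ((Q : φ.toAddMonoidHom.ker) : W.geomPoints) ≠ 0 := fun h0 ↦ by
      rw [show Q = 0 from Subtype.ext h0, addOrderOf_zero] at hQ
      exact hp.one_lt.ne hQ
    have hmemH : (⟨(Q : W.geomPoints), AddSubgroup.torsionBy.nsmul_iff.mpr hQp⟩ :
        geomTorsion W (p : ℤ)) ∈ H := (hHmem _).mpr ((AddMonoidHom.mem_ker).mp Q.2)
    rw [hbot, AddSubgroup.mem_bot] at hmemH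
    exact hQ0 (congrArg Subtype.val hmemH)
  · -- `E[p] ≤ ker φ` would make `E[p]` cyclic, but it has exponent `p` and order `p²`
    have hle : geomTorsion W (p : ℤ) ≤ φ.toAddMonoidHom.ker := fun P hP ↦
      (AddMonoidHom.mem_ker).mpr ((hHmem ⟨P, hP⟩).mp (htop ▸ AddSubgroup.mem_top _))
    haveI : IsAddCyclic φ.toAddMonoidHom.ker := hφ
    haveI : IsAddCyclic (geomTorsion W (p : ℤ)) := AddSubgroup.isAddCyclic_of_le hle
    have hdvd : AddMonoid.exponent (geomTorsion W (p : ℤ)) ∣ p :=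
      AddMonoid.exponent_dvd_of_forall_nsmul_eq_zero fun P ↦ AddSubgroup.torsionBy.nsmul P
    rw [IsAddCyclic.exponent_eq_card,
      natCard_geomTorsion_eq_sq W (Nat.cast_ne_zero.mpr hp.ne_zero)] at hdvd
    have h1 := Nat.le_of_dvd hp.pos hdvd
    have h2 := hp.two_le
    nlinarith

/-- **SUPP (PROVED from H6' B5): prime support `{2, 3}`** — for a Frey curve with an odd conductor
prime `q`, every prime dividing the degree of a cyclic `ℚ`-isogeny out of it is `2` or `3`. -/
theorem frey_primeSupport23
    (h13 : ∀ V : WeierstrassCurve ℚ, MazurTate1973_no_torsion_thirteen V)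
    (hE : Mazur1977_stepThree_eisenstein)
    {a b : ℤ} (hab : IsCoprime a b) (h0 : a * b * (a + b) ≠ 0) {q : ℕ} (hq : q.Prime)
    (hq2 : q ≠ 2) (hqN : q ∣ (freyCurve a b).conductorNorm ℤ) :
    haveI := isElliptic_freyCurve h0
    ∀ (W' : WeierstrassCurve ℚ) [W'.IsElliptic] (ψ : Isogeny (freyCurve a b) W'), ψ.IsCyclic →
      ∀ p : ℕ, p.Prime → p ∣ ψ.degree → p = 2 ∨ p = 3 := by
  haveI := isElliptic_freyCurve h0
  intro W' _ ψ hψ p hp hpd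
  by_contra hne
  obtain ⟨hne2, hne3⟩ := not_or.mp hne
  have h5 : 5 ≤ p := by
    by_contra h
    interval_cases p
    · exact absurd hp (by norm_num)
    · exact absurd hp (by norm_num)
    · exact hne2 rfl
    · exact hne3 rfl
    · exact absurd hp (by norm_num)
  have habs : (a * b * (a + b)).natAbs ≠ 2 := by
    intro h2
    have hdvd : (q : ℤ) ∣ a * b * (a + b) := Literature.NumberTheory.DiophantineGeometry.dvd_of_dvd_conductorNorm_freyCurve hab h0 hq hq2 hqN
    have hq2' : q ∣ 2 := h2 ▸ Int.ofNat_dvd_left.mp hdvd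
    exact hq2 ((Nat.prime_dvd_prime_iff_eq hq Nat.prime_two).mp hq2')
  exact not_dvd_degree_of_hasIrreducibleModPGaloisRep ψ hψ hp
    (hasIrreducibleModPGaloisRep_freyCurve h13 hE hab h0 habs hp h5) hpd

/-- `j(E_(a,b)) ≥ 0` (k2-g2/g3, PROVED; copied). -/
theorem j_freyCurve_nonneg {a b : ℤ} [(freyCurve a b).IsElliptic] (h0 : a * b * (a + b) ≠ 0) :
    0 ≤ (freyCurve a b).j := by
  rw [j_freyCurve h0]
  have hx : 0 ≤ (a : ℚ) ^ 2 + a * b + b ^ 2 := by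
    nlinarith [sq_nonneg ((a : ℚ) + b), sq_nonneg (a : ℚ), sq_nonneg (b : ℚ)]
  exact div_nonneg (mul_nonneg (by norm_num) (pow_nonneg hx 3)) (sq_nonneg _)

/-- **E27** (k2-g2/g3, PROVED; copied): no cyclic sub-degree `27` out of a Frey curve — the
`X₀(27)`-points have `j = −2¹⁵·3·5³ < 0` (tree `Isogeny.j_eq_of_isCyclic_degree_twentySeven`). -/
theorem not_twentySeven_dvd_degree_of_freyCurve {a b : ℤ} (h0 : a * b * (a + b) ≠ 0)
    {W' : WeierstrassCurve ℚ} [W'.IsElliptic] (ψ : Isogeny (freyCurve a b) W')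
    (hψ : ψ.IsCyclic) : ¬ 27 ∣ ψ.degree := by
  haveI := isElliptic_freyCurve h0
  intro h27
  obtain ⟨W'', hW'', χ, hχcyc, hχdeg, -⟩ := ψ.exists_isCyclic_degree_eq_of_dvd hψ h27
  haveI := hW''
  have hj := χ.j_eq_of_isCyclic_degree_twentySeven hχcyc hχdeg
  have hnn := j_freyCurve_nonneg (a := a) (b := b) h0
  rw [hj] at hnn
  norm_num at hnn

/-- **A144 (XS, PROVED).** A positive integer supported on `{2,3}` and divisible by neither `32` nor
`27` is `2^k 3^j` with `k ≤ 4`, `j ≤ 2`, hence `≤ 144`. [folklore] -/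
theorem le_144_of_support {d : ℕ} (hd : d ≠ 0)
    (hsupp : ∀ p : ℕ, p.Prime → p ∣ d → p = 2 ∨ p = 3) (h32 : ¬ 32 ∣ d) (h27 : ¬ 27 ∣ d) :
    d ≤ 144 := by
  have hsub : d.factorization.support ⊆ ({2, 3} : Finset ℕ) := by
    intro p hp
    rw [Nat.support_factorization, Nat.mem_primeFactors] at hp
    rcases hsupp p hp.1 hp.2.1 with rfl | rfl <;> simp
  have hd' : d = 2 ^ d.factorization 2 * 3 ^ d.factorization 3 := by
    conv_lhs => rw [← Nat.prod_factorization_pow_eq_self hd]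
    rw [Finsupp.prod_of_support_subset _ hsub _ (fun i _ ↦ pow_zero i),
      Finset.prod_pair (by decide : (2 : ℕ) ≠ 3)]
  have ha4 : d.factorization 2 ≤ 4 := by
    by_contra h
    have h' := (pow_dvd_pow 2 (show 5 ≤ d.factorization 2 by omega)).trans (Nat.ordProj_dvd d 2)
    norm_num at h'
    exact h32 h'
  have hb2 : d.factorization 3 ≤ 2 := by
    by_contra h
    have h' := (pow_dvd_pow 3 (show 3 ≤ d.factorization 3 by omega)).trans (Nat.ordProj_dvd d 3)
    norm_num at h'
    exact h27 h'
  calc d = 2 ^ d.factorization 2 * 3 ^ d.factorization 3 := hd'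
    _ ≤ 2 ^ 4 * 3 ^ 2 :=
        Nat.mul_le_mul (Nat.pow_le_pow_right (by norm_num) ha4)
          (Nat.pow_le_pow_right (by norm_num) hb2)
    _ = 144 := by norm_num

/-- **R144 (PROVED from SUPP E27 A144 + landed L32): `FreyIsogenyRadius 144`** on the trust base
`{MazurTate1973 (13-torsion), Mazur1977 Step 3 (p ≥ 17)}` — both consumed only in regime T1. -/
theorem freyIsogenyRadius144
    (h13 : ∀ V : WeierstrassCurve ℚ, MazurTate1973_no_torsion_thirteen V)
    (hE : Mazur1977_stepThree_eisenstein) : FreyIsogenyRadius 144 := by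
  intro a b hab h0 q hq hq2 hqN W' _ hiso
  haveI := isElliptic_freyCurve h0
  obtain ⟨ψ, hψ⟩ := hiso.exists_isCyclic
  refine ⟨ψ, le_144_of_support ψ.degree_pos.ne' ?_ ?_ ?_⟩
  · exact frey_primeSupport23 h13 hE hab h0 hq hq2 hqN W' ψ hψ
  · intro h32
    obtain ⟨W'', hW'', χ, hχ, hχd, -⟩ := ψ.exists_isCyclic_degree_eq_of_dvd hψ h32
    haveI := hW''
    exact isogeny_isCyclic_degree_ne_thirtyTwo χ hχ hχd
  · exact not_twentySeven_dvd_degree_of_freyCurve h0 ψ hψ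

/-! ## 5. What the stub supplies, and the crux -/

/-- **VAL (PROVED): the skeleton's `hval` with `163 ↦ R` from a rooted radius `R`** — literally the
type of the conclusion of the landed `stub_valTransport h68` (p96813) with the constant freed
(cyclic core + Tate-curve transport, as k3-g7 V2c). -/
theorem valTransport_of_freyIsogenyRadius {R : ℕ} (hR : FreyIsogenyRadius R) :
    ∀ (a b : ℤ), IsCoprime a b → a * b * (a + b) ≠ 0 → ∀ q : ℕ, q.Prime → q ≠ 2 →
      q ∣ (freyCurve a b).conductorNorm ℤ →
      ∀ (W' : WeierstrassCurve ℚ) [W'.IsElliptic], (freyCurve a b).IsIsogenous W' →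
        (W'.minimalDiscriminantNorm ℤ).factorization q ≤
          R * ((freyCurve a b).minimalDiscriminantNorm ℤ).factorization q := by
  intro a b hab h0 q hq hq2 hqN W' _ hiso
  haveI := isElliptic_freyCurve h0
  obtain ⟨φ, hφ⟩ := hR a b hab h0 q hq hq2 hqN W' hiso
  obtain ⟨v, hv⟩ :
      ∃ v : IsDedekindDomain.HeightOneSpectrum ℤ, Rat.HeightOneSpectrum.natGenerator v = q :=
    ⟨(Rat.HeightOneSpectrum.primesEquiv (R := ℤ)).symm ⟨q, hq⟩,
      Rat.natGenerator_primesEquiv_symm ⟨q, hq⟩⟩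
  have hdvd : (q : ℤ) ∣ a * b * (a + b) := Literature.NumberTheory.DiophantineGeometry.dvd_of_dvd_conductorNorm_freyCurve hab h0 hq hq2 hqN
  have hmult : (freyCurve a b).HasMultiplicativeReductionAt v :=
    Literature.NumberTheory.DiophantineGeometry.hasMultiplicativeReductionAt_freyCurve_of_ne_two
      hab h0 v (hv ▸ hq2) (hv ▸ hdvd)
  have hmult' : W'.HasMultiplicativeReductionAt v :=
    hasMultiplicativeReductionAt_of_isIsogenous ⟨φ⟩ v hmult
  obtain ⟨φ', hcyc, hdvd'⟩ := φ.exists_isCyclic_degree_dvd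
  obtain ⟨m, n, hm, hn, hmn, heq⟩ :=
    exists_ordMinimalDiscriminant_mul_eq_mul_of_isCyclic φ'.degree φ' hcyc rfl v hmult hmult'
  have hnB : n ≤ R :=
    ((Nat.le_mul_of_pos_left n hm).trans
      ((Nat.le_of_dvd φ'.degree_pos hmn).trans (Nat.le_of_dvd φ.degree_pos hdvd'))).trans hφ
  have e1 := factorization_minimalDiscriminantNorm_holds W' v
  have e2 := factorization_minimalDiscriminantNorm_holds (freyCurve a b) v
  rw [hv] at e1 e2
  rw [e1, e2]
  calc W'.ordMinimalDiscriminant v ≤ W'.ordMinimalDiscriminant v * m := Nat.le_mul_of_pos_right _ hm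
    _ = (freyCurve a b).ordMinimalDiscriminant v * n := heq.symm
    _ ≤ (freyCurve a b).ordMinimalDiscriminant v * R := Nat.mul_le_mul_left _ hnB
    _ = R * (freyCurve a b).ordMinimalDiscriminant v := Nat.mul_comm _ _

/-- **hval₁₄₄ (PROVED modulo helpers): the stub's single use in the line, constant `144`, from
`h13 + hE` instead of `h68 : PastenShimura2024_lemma_6_8`.** -/
theorem valTransport144
    (h13 : ∀ V : WeierstrassCurve ℚ, MazurTate1973_no_torsion_thirteen V)
    (hE : Mazur1977_stepThree_eisenstein) :
    ∀ (a b : ℤ), IsCoprime a b → a * b * (a + b) ≠ 0 → ∀ q : ℕ, q.Prime → q ≠ 2 →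
      q ∣ (freyCurve a b).conductorNorm ℤ →
      ∀ (W' : WeierstrassCurve ℚ) [W'.IsElliptic], (freyCurve a b).IsIsogenous W' →
        (W'.minimalDiscriminantNorm ℤ).factorization q ≤
          144 * ((freyCurve a b).minimalDiscriminantNorm ℤ).factorization q :=
  valTransport_of_freyIsogenyRadius (freyIsogenyRadius144 h13 hE)

/-- **G (transplant; PROVED in k2-g4 `StubIdeasK2G4PastenLemma68.lean`, `definiteRTControlPrime_of_rooted`,
rc 0 / 0 sorry, `C = 4R⁴`; Cruxes modules are not importable).**  Takahashi 2001 Thm 2.3 and a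
rooted Frey radius give the crux — `h163` pointwise and `hval` both follow from the radius. -/
theorem definiteRTControlPrime_of_rooted (hT : takahashi2001_thm_2_3_of_coprime) {R : ℕ}
    (hR : FreyIsogenyRadius R) : DefiniteRTControlPrime := by
  sorry

/-- **TOP (kernel-checked composition).  The crux `DefiniteRTControlPrime` on the trust base
`{Takahashi 2001 Thm 2.3, Mazur–Tate 1973 (13-torsion), Mazur 1977 Step 3 (prime torsion ≥ 17)}`**
— no `stub_pasten163`, no `stub_pastenLemma68`, no Mazur 1978, no Kenku beyond the landed 27/32. -/
theorem definiteRTControlPrime_of_takahashi_torsionLeaves (hT : takahashi2001_thm_2_3_of_coprime)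
    (h13 : ∀ V : WeierstrassCurve ℚ, MazurTate1973_no_torsion_thirteen V)
    (hE : Mazur1977_stepThree_eisenstein) : DefiniteRTControlPrime :=
  definiteRTControlPrime_of_rooted hT (freyIsogenyRadius144 h13 hE)

end Summit.ABC.ABC.Cruxes.DefiniteRTControlPrime.StubIdeas3G8

end
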